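/-
Copyright (c) 2026 the pub-hodgecm-mathlib formalisation cell (harness21).  Prover seat hodgecm-mathlib-F0P3a-p01 (g39), lane A (Unr-K, type U) of the (β₂) road, squad
F0∕P3a ∕ F0∕P3c∕LH4; β₂ WORD #42 lane-A leaves ‹LINE-U-A-RAY›∕‹LINE-U-A-MIX›: the cell-level letters of an upper-line LOW cell at a reference pair of ANY radius —
LH7-p09 (g3)'s ★ p865034 `…UpperLowCellLetters.exists_cellLetters_upperLow` with `2n ↦ r`, `|κ₀| ≤ 1 ↦ |κ₀| ≤ |ξ₀|` (as this seat's ★ p864995 did for ★ W2), 2026-09-05.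
-/
import Summits.HodgeConjecture.HodgeConjecture.Theorems.F0P3cDyRamUpperRayCellLetters      -- ★ p864626 (LH4-p19 (g3), W2): `exists_eq_add_two_mul_of_level`, the RAY version; brings ★ p864286 F3 (centre ∕ slope identities, Eisenstein approximation), ★ Lit `v_eq_one_of_v_mul_map_eq_one`
import HarnessLib

/-!
# Crux `H413`, line LH4 «(D-RAM) FOUR-FRAME» — STAGE-1b, row (2), the (β₂) road (R-36), (OFF) residue, UPPER line: «THE CELL LETTERS OF AN UPPER-LINE LOW CELL AT ANY RADIUS» —
# ★ p865034's HEAD (★ W2 without the RAY premise) at a reference pair `|ξ₀| = e^{r}`, `j = b + r`, `|κ₀| ≤ |ξ₀|` instead of `|ξ₀| = e^{2n}`, `|κ₀| ≤ 1`: the centre `W`, the slope `BE`, `σ`-fixed `γ₁, W₁` with the SLOPE and ROOT letters, the digit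
# sizes `|γ₁|·|ϖ|^b = |ϖ|^{s−ℓ₀}`, `1 ≤ |γ₁|`, `|ϖ|^{2d−2} ≤ |γ₁|·|ϖ|^{2d−1}`, `|W₁| ≤ 1` — everything except the RAY size `|γ₁|·|ϖ|^b ≤ |ϖ|^{2d−1}`

Cell `hodgecm-mathlib` (D-0151), FLOOR 0, crux item H413 = `stmt-HodgeConjecture-24833`, route of record `HCCMUnconditional`; squads F0∕P3a ∕ F0∕P3c∕LH4 ∕ LH7; lane
`--supports stmt-HodgeConjecture-24833 --as helper` (count-neutral; pays NO tier-0 row).  THEOREMS ONLY (no `def`, no instance, no notation, no `sorry`, default heartbeats);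
★-only imports; states NO law; (β₂) stays a HYPOTHESIS.  Frame = ★ W2's VERBATIM (opened ‹OFF.letter.v2› letters: the E-datum, the `jE`-letters, `ρ`, `Θ`, the line model's
`lam`, the deep token `|lam − 1| ≤ |ϖE|^{3d−2}`, the `u`-entry, the sizes `|μ| = e^{−m}`, `|μ − ρμ| = e^{−jl}`) and the cell: `j = b + r`, `j + m = jl + b` (upper line),
`m < 2b`, LOW `m_c + 2b ≤ 2m` (spelled out) — but NOT the RAY band; reference pair letters `(R2)` `|ξ₀| = e^r`, `(R3)` `|κ₀| ≤ |ξ₀|`.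
`exists_cellLetters_upperLow_of_radius` = ★ p865034 with `(hjbn : j = b + 2n) (hκ₀1 : |κ₀| ≤ 1) (hξv : |ξ₀| = e^{2n})` ↦ `(hjbr : j = b + r) (hκ₀v : |κ₀| ≤ |ξ₀|) (hξv : |ξ₀| = e^r)`,
proof token for token (`2n ↦ r` in `hjl2 hBEv hκcv`, the `|W| ≤ 1` step closed by `hκ₀v`), conclusion BYTE FOR BYTE ★'s.  Lane B recovers ★ at `r := 2n`; lane A (type U,
no Θ-fixed trace-one INTEGRAL `κ₀`: ★ p864921) instantiates it on the hyperbolic tower `j = b + d + 2i` with ★ p864994 road (I) (`|κ₀| = e^{d−1}`, `|ξ₀| = e^{d+2i}`).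

WHY (β₂ WORD #42 lane A; consumer: this seat's lane-A upper LOW worker `cellDiff_upperLine_low_eq_zero_of_hyper_A`; LH7-p09's text follows).  The digit road of ★ W3 (LH4-p19 (g3)) is UNIFORM on the upper line's LOW band: every exponent letter of the
socket reads `c′ = b + ℓ₀ − s ≥ 1` (⟸ `m < 2b`), `s ≥ d + ℓ₀` or `2s ≥ m_c` (⟸ LOW) once the generator independence is the SHARP one (★ p864599) and the radius is
`r = |ϖ|^{2d−1+c′}`; the RAY premise entered ★ W2 only through the size `|γ₁|·|ϖ|^b ≤ |ϖ|^{2d−1}` (the transfer letter of ★ p864148's radius), which the MIX worker does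
not use.  This file is ★ W2's proof with that one conjunct (and `hray`) deleted; nothing else changes.
* HEAD `exists_cellLetters_upperLow_of_radius`.
HONEST LABEL.  Count-neutral algebra; nothing printed is asserted; no census law is stated; ‹LINE-U-A-RAY›, ‹LINE-U-A-MIX› stay OPEN; `HC_CM` is proved only modulo the 7 printed
citations (2 remaining named inputs: hLiu418 = `stmt-HodgeConjecture-24832`, h413 = `stmt-HodgeConjecture-24833`) until rung 0 closes.
## References
* [Kottwitz1986BaseChangeUnits] R. E. Kottwitz, *Base change for unit elements of Hecke algebras*, Compositio Math. 60 (1986): §3 (the cell constants of a cone cell).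
* [Serre1979] J.-P. Serre, *Local Fields*, GTM 67 (1979): Ch. III §6 Prop. 12 (Eisenstein coordinates), Ch. V §3 (even valuation of fixed elements), Ch. XV §2.
* [Rogawski1990] J. D. Rogawski, *Automorphic Representations of Unitary Groups in Three Variables*, Ann. of Math. Stud. 123 (1990): §4.9 Prop. 4.9.1 (b) p. 55, §12.2.
-/

set_option autoImplicit false

noncomputable section

namespace Summit.HodgeConjecture.HodgeConjecture.Cruxes.H413.F0P3cDyRamUpperLowCellLettersAnyRadius

open scoped Valued WithZero
open WithZero
open Literature.NumberTheory.Automorphic.UnitaryThreeFourFrame (IsRamifiedQuadraticDatum)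
open Literature.NumberTheory.LocalFields.WildQuadraticDatum (v_eq_one_of_v_mul_map_eq_one)
open Literature.NumberTheory.Rogawski1990
open Summit.HodgeConjecture.HodgeConjecture.Cruxes.H413.F0P3cDyRamToricCensusDefs
open Summit.HodgeConjecture.HodgeConjecture.Cruxes.H413.F0P3cDyRamUpperLineCellCentre

variable {E M : Type} [Field E] [Valued E ℤᵐ⁰] [Field M] [Valued M ℤᵐ⁰] {ρ Θ : M →+* M}

/-- **HEAD — «THE CELL LETTERS OF AN UPPER-LINE LOW CELL» (no RAY premise).**  ★ W2 `exists_cellLetters`'s frame and letters VERBATIM minus `hray`: the cell `j = b + 2n`,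
`j = b + r`, `j + m = jl + b`, `m < 2b`, LOW `3d − 2 + d%2 + 2b ≤ 2m`; the reference pair with `|κ₀| ≤ |ξ₀|`, `|ξ₀| = e^{r}`.  Outputs `W BE γ₁ W₁ : E` with: `jE W·ξ₀ = ρμ∕(ρμ − μ) − κ₀`;
`jE BE = (μ − ρμ)·ξ₀`; `σγ₁ = γ₁`; `σW₁ = W₁`; SLOPE `|BE∕(P·t₊) − γ₁| ≤ |γ₁|·|ϖ|^{2d−1}`; ROOT `|γ₁(W − W₁)| ≤ |ϖ|^{2d−1}`; `|γ₁|·|ϖ|^b = |ϖ|^{m−b−d%2}`; `1 ≤ |γ₁|`;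
`|ϖ|^{2d−2} ≤ |γ₁|·|ϖ|^{2d−1}`; `|W₁| ≤ 1` — ★ W2's conclusion minus the RAY size `|γ₁|·|ϖ|^b ≤ |ϖ|^{2d−1}` (the only conjunct that used `hray`).
[cite: Kottwitz1986BaseChangeUnits, §3] [cite: Serre1979, Ch. III §6 Prop. 12; Ch. XV §2] [cite: Rogawski1990, §4.9 Prop. 4.9.1 (b) p. 55] -/
theorem exists_cellLetters_upperLow_of_radius {σ : E →+* E} {ϖ : E} {d tE : ℕ} (hD : IsRamifiedQuadraticDatum σ ϖ d tE)
    (jE : E →+* M) (hjiso : ∀ a, Valued.v (jE a) = Valued.v a) (hjfix : ∀ z, ρ z = z ↔ ∃ c, jE c = z) (hΘj : ∀ c, Θ (jE c) = jE (σ c))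
    (hρρ : ∀ x, ρ (ρ x) = x) (hvρ : ∀ x, Valued.v (ρ x) = Valued.v x) (hΘρ : ∀ x, Θ (ρ x) = ρ (Θ x))
    {lam : M} (hΘlam : Θ lam * lam = 1) (hvlam : Valued.v lam = 1)
    {tr det : E} (hdet : det * σ det = 1) (hlam2 : lam * lam = jE tr * lam - jE det) (hρlam : ρ lam = jE tr - lam)
    (hlam3 : Valued.v (lam - 1) ≤ Valued.v (jE ϖ) ^ (3 * d - 2))
    {u : E} (huu : u * σ u = 1) (hu : Valued.v u = 1)
    {m jl : ℕ} (hm : Valued.v (lam - jE u) = exp (-(m : ℤ))) (hjl : Valued.v ((lam - jE u) - ρ (lam - jE u)) = exp (-(jl : ℤ)))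
    {j b r : ℕ} (hjbr : j = b + r) (hline : j + m = jl + b) (h2bm : m < 2 * b)
    (hlow : 3 * d - 2 + d % 2 + 2 * b ≤ 2 * m)
    {κ₀ ξ₀ : M} (hκ₀ : κ₀ + ρ κ₀ = 1) (hΘκ₀ : Θ κ₀ = κ₀) (hξ : ρ ξ₀ = -ξ₀) (hΘξ : Θ ξ₀ = ξ₀) (hξ0 : ξ₀ ≠ 0)
    (hκ₀v : Valued.v κ₀ ≤ Valued.v ξ₀) (hξv : Valued.v ξ₀ = exp (r : ℤ)) :
    ∃ W BE γ₁ W₁ : E,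
      jE W * ξ₀ = ρ (lam - jE u) / (ρ (lam - jE u) - (lam - jE u)) - κ₀ ∧
      jE BE = ((lam - jE u) - ρ (lam - jE u)) * ξ₀ ∧ σ γ₁ = γ₁ ∧ σ W₁ = W₁ ∧
      Valued.v (BE / ((ϖ * σ ϖ) ^ b * ((ϖ - σ ϖ) * ((ϖ * σ ϖ) ^ ((d - d % 2) / 2))⁻¹)) - γ₁) ≤ Valued.v γ₁ * Valued.v ϖ ^ (2 * d - 1) ∧
      Valued.v (γ₁ * (W - W₁)) ≤ Valued.v ϖ ^ (2 * d - 1) ∧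
      Valued.v γ₁ * Valued.v ϖ ^ b = Valued.v ϖ ^ (m - b - d % 2) ∧ 1 ≤ Valued.v γ₁ ∧
      Valued.v ϖ ^ (2 * d - 2) ≤ Valued.v γ₁ * Valued.v ϖ ^ (2 * d - 1) ∧ Valued.v W₁ ≤ 1 := by
  obtain ⟨hσσ, hvσ, hϖ, -, hd, hd1, -⟩ := id hD
  have hvϖ0 : Valued.v ϖ ≠ 0 := by rw [hϖ]; exact exp_ne_zero
  have hϖ0 : ϖ ≠ 0 := fun h0 => hvϖ0 (by rw [h0, map_zero])
  have hϖpos : (0 : ℤᵐ⁰) < Valued.v ϖ := zero_lt_iff.2 hvϖ0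
  have hϖlt : Valued.v ϖ < 1 := by rw [hϖ, ← exp_zero, exp_lt_exp]; norm_num
  have hσϖ0 : σ ϖ ≠ 0 := (map_ne_zero σ).2 hϖ0
  have hPnE : ∀ k : ℕ, Valued.v ϖ ^ k = exp (-(k : ℤ)) := fun k => by rw [hϖ, ← exp_nsmul]; congr 1; simp
  have hρj : ∀ c : E, ρ (jE c) = jE c := fun c => (hjfix _).2 ⟨c, rfl⟩
  have hϖσ : σ ϖ ≠ ϖ := fun h => by rw [h, sub_self, map_zero] at hd; exact pow_ne_zero _ hvϖ0 hd.symm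
  have hjl2 : (jl : ℤ) = r + m := by push_cast [hjbr] at hline ⊢; omega
  have hμρ : ρ (lam - jE u) ≠ lam - jE u := fun h => by
    rw [h, sub_self, map_zero] at hjl; exact exp_ne_zero hjl.symm
  have hξpos : (0 : ℤᵐ⁰) < Valued.v ξ₀ := zero_lt_iff.2 ((Valuation.ne_zero_iff _).2 hξ0)
  -- the centre coordinate and the slope
  obtain ⟨W, hWc⟩ := exists_centre_coord jE hjfix hρρ hμρ hκ₀ hξ hξ0
  have hρB : ρ (((lam - jE u) - ρ (lam - jE u)) * ξ₀) = ((lam - jE u) - ρ (lam - jE u)) * ξ₀ := by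
    rw [map_mul, map_sub, hρρ, hξ]; ring
  obtain ⟨BE, hBE⟩ := (hjfix _).1 hρB
  -- determinant letters
  have hdetv : Valued.v det = 1 := v_eq_one_of_v_mul_map_eq_one hvσ (by rw [hdet]; exact map_one _)
  have hdet0 : det ≠ 0 := fun h0 => by rw [h0, map_zero] at hdetv; exact zero_ne_one hdetv
  have hll : lam * ρ lam = jE det := by
    have e : lam * ρ lam = jE tr * lam - lam * lam := by rw [hρlam]; ring
    rw [e, hlam2]; ring
  have hdet1 : Valued.v (det - 1) ≤ Valued.v ϖ ^ (3 * d - 2) := by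
    rw [← hjiso, map_sub, map_one, ← hll, ← hjiso ϖ]
    have e : lam * ρ lam - 1 = (lam - 1) * ρ lam + ρ (lam - 1) := by rw [map_sub, map_one]; ring
    rw [e]
    refine (Valuation.map_add _ _ _).trans (max_le ?_ ?_)
    · rw [Valuation.map_mul, hvρ, hvlam, mul_one]; exact hlam3
    · rw [hvρ]; exact hlam3
  -- `σ` of the slope: `σB = −B ∕ det`
  have hl0 : lam ≠ 0 := fun h0 => by rw [h0, map_zero] at hvlam; exact zero_ne_one hvlam
  have hρl0 : ρ lam ≠ 0 := fun h0 => hl0 (by rw [← hρρ lam, h0, map_zero])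
  have hσBE : σ BE = -BE / det := jE.injective (by
    rw [← hΘj, map_div₀, map_neg, hBE, map_mul, hΘξ, ← hll, map_skew_eq_neg_div σ jE hΘj hρj hΘρ hΘlam huu]
    field_simp)
  set P : E := (ϖ * σ ϖ) ^ b with hPdef
  set tp : E := (ϖ - σ ϖ) * ((ϖ * σ ϖ) ^ ((d - d % 2) / 2))⁻¹ with htpdef
  have hσP : σ P = P := by rw [hPdef, map_pow, map_mul, hσσ, mul_comm (σ ϖ) ϖ]
  have hσtp : σ tp = -tp := by
    rw [htpdef, map_mul, map_inv₀, map_pow, map_mul, map_sub, hσσ, mul_comm (σ ϖ) ϖ]; ring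
  have hP0 : P ≠ 0 := pow_ne_zero _ (mul_ne_zero hϖ0 hσϖ0)
  have hPv : Valued.v P = Valued.v ϖ ^ (2 * b) := by rw [hPdef, Valuation.map_pow, Valuation.map_mul, hvσ, ← pow_two, ← pow_mul]
  have htpv : Valued.v tp = Valued.v ϖ ^ (d % 2) := by
    have h1 : Valued.v tp * Valued.v ϖ ^ (2 * ((d - d % 2) / 2)) = Valued.v ϖ ^ d := by
      rw [htpdef, Valuation.map_mul, Valuation.map_inv, Valuation.map_pow, Valuation.map_mul, hvσ, ← pow_two, ← pow_mul, hd,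
        inv_mul_cancel_right₀ (pow_ne_zero _ hvϖ0)]
    have h2 : Valued.v ϖ ^ d = Valued.v ϖ ^ (d % 2) * Valued.v ϖ ^ (2 * ((d - d % 2) / 2)) := by rw [← pow_add]; congr 1; omega
    exact mul_right_cancel₀ (pow_ne_zero _ hvϖ0) (h1.trans h2)
  have htp0 : tp ≠ 0 := fun h0 => by rw [h0, map_zero] at htpv; exact pow_ne_zero _ hvϖ0 htpv.symm
  -- the slope ratio `θ` and its `σ`
  set θ : E := BE / (P * tp) with hθdef
  have hBE0 : BE ≠ 0 := fun h0 => by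
    have : ((lam - jE u) - ρ (lam - jE u)) * ξ₀ = 0 := by rw [← hBE, h0, map_zero]
    exact mul_ne_zero (sub_ne_zero.2 (Ne.symm hμρ)) hξ0 this
  have hθ0 : θ ≠ 0 := div_ne_zero hBE0 (mul_ne_zero hP0 htp0)
  have hθpos : (0 : ℤᵐ⁰) < Valued.v θ := zero_lt_iff.2 ((Valuation.ne_zero_iff _).2 hθ0)
  have hσθ : σ θ = θ / det := by
    rw [hθdef, map_div₀, map_mul, hσBE, hσP, hσtp]; field_simp
  have hθσv : Valued.v (θ - σ θ) ≤ Valued.v θ * Valued.v ϖ ^ (3 * d - 2) := by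
    have e : θ - σ θ = θ * ((det - 1) / det) := by rw [hσθ]; field_simp
    rw [e, Valuation.map_mul, map_div₀ _ (det - 1) det, hdetv, div_one]; exact mul_le_mul' le_rfl hdet1
  -- Eisenstein approximation of the slope ratio
  obtain ⟨γ₁, hσγ, hγ⟩ := exists_fixed_v_sub_mul_eq hσσ hϖσ θ
  have hθγ : Valued.v (θ - γ₁) ≤ Valued.v θ * Valued.v ϖ ^ (2 * d - 1) := by
    have h1 : Valued.v (θ - γ₁) * Valued.v ϖ ^ d ≤ Valued.v θ * Valued.v ϖ ^ (2 * d - 1) * Valued.v ϖ ^ d := by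
      rw [← hd, hγ]
      calc Valued.v (θ - σ θ) * Valued.v ϖ ≤ Valued.v θ * Valued.v ϖ ^ (3 * d - 2) * Valued.v ϖ := mul_le_mul' hθσv le_rfl
        _ = Valued.v θ * Valued.v ϖ ^ (2 * d - 1) * Valued.v (ϖ - σ ϖ) := by
          rw [hd, mul_assoc, mul_assoc, ← pow_succ, ← pow_add]; congr 2; omega
    have h2 := (div_le_iff₀ (pow_pos hϖpos d)).2 h1
    rwa [mul_div_assoc, div_self (pow_ne_zero _ hvϖ0), mul_one] at h2
  have h2d1 : Valued.v ϖ ^ (2 * d - 1) < 1 := pow_lt_one₀ zero_le hϖlt (by omega)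
  have hθlt : Valued.v (θ - γ₁) < Valued.v θ :=
    hθγ.trans_lt (by
      calc Valued.v θ * Valued.v ϖ ^ (2 * d - 1) < Valued.v θ * 1 := mul_lt_mul_of_pos_left h2d1 hθpos
        _ = Valued.v θ := mul_one _)
  have hγv : Valued.v γ₁ = Valued.v θ := by
    have e : γ₁ = θ - (θ - γ₁) := by ring
    rw [e, Valuation.map_sub_eq_of_lt_left _ hθlt]
  -- the size of `θ`: `|θ| = e^{2b + ℓ₀ − m}`
  have hBEv : Valued.v BE = exp (-(jl : ℤ)) * exp (r : ℤ) := by rw [← hjiso, hBE, Valuation.map_mul, hjl, hξv]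
  have hθv : Valued.v θ = exp (2 * (b : ℤ) + (d % 2 : ℕ) - m) := by
    rw [hθdef, Valuation.map_div, Valuation.map_mul, hBEv, hPv, htpv, hPnE, hPnE, ← exp_add, ← exp_add, ← exp_sub]
    congr 1; push_cast; omega
  -- the root: `|W − σW| = e^{−m}`, Eisenstein `W₁`
  have hκcv : Valued.v (ρ (lam - jE u) / (ρ (lam - jE u) - (lam - jE u))) = exp (r : ℤ) := by
    rw [v_centre_eq hvρ (lam - jE u), hm, hjl, ← exp_sub]; congr 1; omega
  have hWσ : Valued.v (W - σ W) = exp (-(m : ℤ)) := by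
    have h1 := map_centre_coord_sub σ jE hΘj hΘκ₀ hΘξ hWc
    have h3 : ρ (lam - jE u) / (ρ (lam - jE u) - (lam - jE u)) - Θ (ρ (lam - jE u) / (ρ (lam - jE u) - (lam - jE u))) =
        -(ρ (lam - jE u) / (ρ (lam - jE u) - (lam - jE u)) * ((lam - jE u) / jE u)) := by
      rw [← neg_sub, map_centre_sub_centre σ jE hΘj hρj hΘρ hΘlam huu hμρ]
    have h2 : Valued.v (W - σ W) * Valued.v ξ₀ = exp (-(m : ℤ)) * Valued.v ξ₀ := by
      rw [← hjiso (W - σ W), ← Valuation.map_mul, h1.trans h3, Valuation.map_neg, Valuation.map_mul, hκcv, Valuation.map_div, hm,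
        hjiso u, hu, div_one, hξv, mul_comm]
    exact mul_right_cancel₀ ((Valuation.ne_zero_iff _).2 hξ0) h2
  obtain ⟨W₁, hσW₁, hW1⟩ := exists_fixed_v_sub_mul_eq hσσ hϖσ W
  have hWWv : Valued.v (W - W₁) = exp (-(m : ℤ) - 1 + d) := by
    have h1 : Valued.v (W - W₁) * exp (-(d : ℤ)) = exp (-(m : ℤ) + (-1)) := by rw [← hPnE, ← hd, hW1, hWσ, hϖ, exp_add]
    rw [(eq_mul_inv_iff_mul_eq₀ exp_ne_zero).2 h1, ← exp_neg, ← exp_add]; congr 1; ring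
  have hWW : Valued.v (γ₁ * (W - W₁)) ≤ Valued.v ϖ ^ (2 * d - 1) := by
    rw [Valuation.map_mul, hγv, hθv, hWWv, ← exp_add, hPnE, exp_le_exp]; push_cast; omega
  have hWle : Valued.v W ≤ 1 := by
    have h1 : Valued.v (jE W) * Valued.v ξ₀ ≤ 1 * Valued.v ξ₀ := by
      rw [← Valuation.map_mul, hWc, one_mul]
      exact (Valuation.map_sub _ _ _).trans (max_le (by rw [hκcv, hξv]) hκ₀v)
    have h2 := (le_div_iff₀ hξpos).2 h1
    rwa [mul_div_assoc, div_self (ne_of_gt hξpos), mul_one, hjiso] at h2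
  have hW₁1 : Valued.v W₁ ≤ 1 := by
    have e : W₁ = W - (W - W₁) := by ring
    rw [e]
    refine (Valuation.map_sub _ _ _).trans (max_le hWle ?_)
    rw [hWWv, ← exp_zero, exp_le_exp]; omega
  -- the digit sizes
  have hγn : Valued.v γ₁ * Valued.v ϖ ^ b = Valued.v ϖ ^ (m - b - d % 2) := by
    rw [hγv, hθv, hPnE, hPnE, ← exp_add, exp_inj]; push_cast; omega
  have hγ1 : 1 ≤ Valued.v γ₁ := by rw [hγv, hθv, ← exp_zero, exp_le_exp]; push_cast; omega
  have hγe : Valued.v ϖ ^ (2 * d - 2) ≤ Valued.v γ₁ * Valued.v ϖ ^ (2 * d - 1) := by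
    rw [hγv, hθv, hPnE, hPnE, ← exp_add, exp_le_exp]; push_cast; omega
  exact ⟨W, BE, γ₁, W₁, hWc, hBE, hσγ, hσW₁, by rw [hγv]; exact hθγ, hWW, hγn, hγ1, hγe, hW₁1⟩

end Summit.HodgeConjecture.HodgeConjecture.Cruxes.H413.F0P3cDyRamUpperLowCellLettersAnyRadius

end
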